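import Summits.AtomisticToContinuum.Crystallization.Theorems.HcpThetaUniversalityBarlowThetaDominance
import Summits.AtomisticToContinuum.Crystallization.Theorems.HcpThetaUniversalityThetaMaxImpliesSutherlandBound
import Summits.AtomisticToContinuum.Crystallization.Theorems.MinMeanCycleStackingLockBarlowEnergyIdentification

/-!
# `SutherlandBound` (stmt-AtomisticToContinuum-3268) within the Barlow class: hcp has the largest `r⁻⁶` site energy

The item `SutherlandBound` ("hcp maximises the van der Waals attraction `Σ r⁻⁶` among all unit
sphere packings of `ℝ³`") is open.  This file proves it for the physically relevant competitors,
the close-packed polytypes (Barlow stackings): for every Hägg word `s`, all spacings `a, h > 0`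
and every layer `m`,

`barlowSiteEnergy (r ↦ r⁻⁶) a h s m ≤ barlowSiteEnergy (r ↦ r⁻⁶) a h alternatingHagg 0`

(`barlowSiteEnergy_invSix_le_alternating`) — the `r⁻⁶` analogue of the Gaussian
`BarlowThetaDominance` (stmt-5060, `barlowSiteEnergy_gauss_le_alternating`), i.e. the lattice-sum
comparison "hcp beats fcc and every other stacking for the London dispersion energy"
(Kihara–Koba 1952; Stillinger 2001) made rigorous for ALL stackings and sitewise.

Proof.  By Bernstein/Euler, `d⁻⁶ = ∫₀^∞ ½ t² e^{-t d²} dt`, so by Tonelli (in `ℝ≥0∞`) the `r⁻⁶`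
interaction of a site with a layer at distance `k ≠ 0` and lateral class `δ` is
`Φ₆(δ, k) = ∫₀^∞ ½ t² e^{-t (k h)²} Θ_δ(t) dt` with the planar Gaussian sums
`Θ_δ(t) = Σ_{ij} e^{-t ‖i u + j v + δ w‖²}` (`ofReal_layerInteraction_invSix_eq_lintegral`).
Banaszczyk's coset inequality `Θ_N ≤ Θ_A` (`layerInteraction_one_zero_le`) then gives that the
couplings `J_k = Φ₆(A, k) − Φ₆(N, k)` are `≥ 0` and non-increasing in `k ≥ 1`
(`barlowCoupling_invSix_nonneg`, `barlowCoupling_invSix_succ_le`), and the monotone pairing of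
`BarlowThetaDominance` (`tsum_ite_le_tsum_ite_even`: a Hägg word never aligns two consecutive
ranges) concludes exactly as in the Gaussian case.  Summability of the `r⁻⁶` layer sums is that of
the Bravais lattice `ℤ u + ℤ v + ℤ h e₃` seen from `−δ w` (`summable_layerInteraction_invSix`).

[folklore]
-/

noncomputable section

namespace Summit.AtomisticToContinuum.Crystallization.Theorems

open MeasureTheory Set
open scoped ENNReal
open Literature.MathematicalPhysics.StatisticalMechanics
open Summit.AtomisticToContinuum.Crystallization.Theorems.PricedHcpWindowsSitewise
  (not_haggAligned_succ)
open Summit.AtomisticToContinuum.Crystallization.Theorems.BarlowTheta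
  (tsum_ite_le_tsum_ite_even not_haggAligned_sub_succ linearIndependent_triangularVec
    layerInteraction_one_zero_le)

variable {a h : ℝ}

/-! ## Summability of the `r⁻⁶` sums over a Barlow stacking -/

/-- **`r⁻⁶` is summable over a periodic Barlow stacking in the parametrisation by `ℤ³`**
(`a, h > 0`, `s` `p`-periodic): from any point `x` of `ℝ³` (the possible term `y = x` is
`0⁻¹ ^ 6 = 0`). [folklore] -/
theorem summable_invSix_barlowPos (ha : 0 < a) (hh : 0 < h) {s : ℤ → ℤ} {p : ℕ} (hp : p ≠ 0)
    (hs : ∀ i, s (i + p) = s i) (x : EuclideanSpace ℝ (Fin 3)) :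
    Summable fun q : ℤ × ℤ × ℤ => (dist x (barlowPos a h s q.1 q.2.1 q.2.2))⁻¹ ^ 6 := by
  set P := barlowPeriodicConfiguration s ha.ne' hh.ne' hp hs with hPdef
  have hP : P.points = barlowStacking a h s := barlowPeriodicConfiguration_points s ha.ne' hh.ne' hp hs
  have hF := P.summable_inv_pow_six_dist (by norm_num) x
  set g : ℤ × ℤ × ℤ → EuclideanSpace ℝ (Fin 3) := fun q => barlowPos a h s q.1 q.2.1 q.2.2
    with hgdef
  have hg : Function.Injective g := barlowPos_injective ha hh s
  have hS : (g ⁻¹' {x}).Finite := (Set.subsingleton_singleton.preimage hg).finite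
  have hmem : ∀ q, g q ∈ P.points := fun q => by
    rw [hP]
    exact barlowPos_mem _ _ _
  let φ : ↥(g ⁻¹' {x})ᶜ → {y // y ∈ P.points ∧ y ≠ x} :=
    fun c => ⟨g c.1, hmem c.1, fun hc => c.2 hc⟩
  have hφ : Function.Injective φ := by
    intro c c' hcc'
    have h1 : g c.1 = g c'.1 := congrArg Subtype.val hcc'
    exact Subtype.ext (hg h1)
  have h1 : Summable ((fun y : {y // y ∈ P.points ∧ y ≠ x} => (dist x y.1)⁻¹ ^ 6) ∘ φ) :=
    hF.comp_injective hφ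
  have h2 : Summable ((fun q : ℤ × ℤ × ℤ => (dist x (g q))⁻¹ ^ 6) ∘
      ((↑) : ↥(g ⁻¹' {x})ᶜ → ℤ × ℤ × ℤ)) := h1
  exact hS.summable_compl_iff.1 h2

/-- The `r⁻⁶` sum over the Bravais lattice `ℤ u + ℤ v + ℤ h e₃` seen from `−δ w` is summable:
`(k, i, j) ↦ ‖layerVec a h δ k i j‖⁻⁶` is summable over `ℤ³`. [folklore] -/
theorem summable_invSix_layerVec (ha : 0 < a) (hh : 0 < h) (δ : ℤ) :
    Summable fun q : ℤ × ℤ × ℤ => ‖layerVec a h δ q.1 q.2.1 q.2.2‖⁻¹ ^ 6 := by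
  have hs : ∀ i : ℤ, (fun _ : ℤ => (0 : ℤ)) (i + (1 : ℕ)) = (fun _ : ℤ => (0 : ℤ)) i :=
    fun _ => rfl
  have hF := summable_invSix_barlowPos (s := fun _ : ℤ => (0 : ℤ)) (p := 1) ha hh one_ne_zero hs
    (-((δ : ℝ) • barlowOffset a))
  exact hF.congr fun q => by rw [dist_neg_smul_barlowOffset_barlowPos]

/-- Each layer sum `(i, j) ↦ ‖layerVec a h δ k i j‖⁻⁶` is summable. [folklore] -/
theorem summable_invSix_layerVec_layer (ha : 0 < a) (hh : 0 < h) (δ k : ℤ) :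
    Summable fun ij : ℤ × ℤ => ‖layerVec a h δ k ij.1 ij.2‖⁻¹ ^ 6 :=
  (summable_invSix_layerVec ha hh δ).prod_factor k

/-- **The `r⁻⁶` layer interactions are summable over the layer distance** (`a, h > 0`, any
lateral class `δ`); in particular the aligned and non-aligned interactions `Φ_A = Φ₆(0, ·)`,
`Φ_N = Φ₆(1, ·)` are. [folklore] -/
theorem summable_layerInteraction_invSix (ha : 0 < a) (hh : 0 < h) (δ : ℤ) :
    Summable fun k : ℕ => layerInteraction (fun r => r⁻¹ ^ 6) a h δ k := by
  have hG : Summable fun k : ℤ => layerInteraction (fun r => r⁻¹ ^ 6) a h δ k :=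
    (summable_invSix_layerVec ha hh δ).prod
  exact hG.comp_injective Nat.cast_injective

/-- The planar Gaussian sums `(i, j) ↦ e^{-t ‖i u + j v + δ w‖²}` are summable (`a ≠ 0`,
`t > 0`). [folklore] -/
theorem summable_gauss_layerVec (ha : a ≠ 0) {t : ℝ} (ht : 0 < t) (h' : ℝ) (δ : ℤ) :
    Summable fun ij : ℤ × ℤ => Real.exp (-t * ‖layerVec a h' δ 0 ij.1 ij.2‖ ^ 2) := by
  have hS := Literature.Algebra.EuclideanLattices.summable_exp_neg_mul_norm_zsmul_add_zsmul_sub_sq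
    (linearIndependent_triangularVec ha) ht (-((δ : ℝ) • barlowOffset a))
  refine hS.congr fun ij => ?_
  simp only [layerVec, sub_neg_eq_add, Int.cast_zero, zero_smul, add_zero]

/-! ## Bernstein representation of the `r⁻⁶` layer sums -/

/-- Pythagoras for the layer vectors: `‖i u + j v + δ w + k h e₃‖² = ‖i u + j v + δ w‖² + (k h)²`.
[folklore] -/
theorem norm_layerVec_sq_eq (a h : ℝ) (δ k i j : ℤ) :
    ‖layerVec a h δ k i j‖ ^ 2 = ‖layerVec a h δ 0 i j‖ ^ 2 + ((k : ℝ) * h) ^ 2 := by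
  rw [norm_layerVec, norm_layerVec, Real.sq_sqrt (by positivity), Real.sq_sqrt (by positivity)]
  push_cast
  ring

/-- Off the central layer the layer vectors are non-zero: `‖layerVec a h δ k i j‖ > 0` for
`k ≠ 0`, `h ≠ 0`. [folklore] -/
theorem norm_layerVec_pos (a : ℝ) {h : ℝ} (hh : h ≠ 0) (δ : ℤ) {k : ℤ} (hk : k ≠ 0) (i j : ℤ) :
    0 < ‖layerVec a h δ k i j‖ := by
  have h1 : 0 < ((k : ℝ) * h) ^ 2 := by
    have : (k : ℝ) * h ≠ 0 := mul_ne_zero (Int.cast_ne_zero.2 hk) hh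
    positivity
  have h2 : 0 < ‖layerVec a h δ k i j‖ ^ 2 := by
    rw [norm_layerVec_sq_eq]
    linarith [sq_nonneg ‖layerVec a h δ 0 i j‖]
  rcases (norm_nonneg (layerVec a h δ k i j)).eq_or_lt with h0 | h0
  · rw [← h0] at h2
    norm_num at h2
  · exact h0

/-- **Bernstein representation, `ℝ≥0∞` form.** For `k ≠ 0`:
`Φ₆(δ, k) = ∫₀^∞ ½ t² e^{-t (k h)²} · Σ_{ij} e^{-t ‖i u + j v + δ w‖²} dt`
(Euler's integral termwise and Tonelli). [folklore] -/
theorem ofReal_layerInteraction_invSix_eq_lintegral (ha : 0 < a) (hh : 0 < h) (δ : ℤ) {k : ℤ}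
    (hk : k ≠ 0) :
    ENNReal.ofReal (layerInteraction (fun r => r⁻¹ ^ 6) a h δ k) =
      ∫⁻ t in Ioi (0 : ℝ), ENNReal.ofReal (1 / 2 * t ^ 2 * Real.exp (-t * ((k : ℝ) * h) ^ 2)) *
        ∑' ij : ℤ × ℤ, ENNReal.ofReal (Real.exp (-t * ‖layerVec a h δ 0 ij.1 ij.2‖ ^ 2)) := by
  unfold layerInteraction
  rw [ENNReal.ofReal_tsum_of_nonneg (fun ij => by positivity)
    (summable_invSix_layerVec_layer ha hh δ k)]
  have hpos : ∀ ij : ℤ × ℤ, 0 < ‖layerVec a h δ k ij.1 ij.2‖ := fun ij =>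
    norm_layerVec_pos a hh.ne' δ hk ij.1 ij.2
  have hmeas : ∀ ij : ℤ × ℤ, AEMeasurable (fun t : ℝ =>
      ENNReal.ofReal (1 / 2 * t ^ 2 * Real.exp (-t * ‖layerVec a h δ k ij.1 ij.2‖ ^ 2)))
        (volume.restrict (Ioi (0 : ℝ))) := fun ij => by fun_prop
  calc ∑' ij : ℤ × ℤ, ENNReal.ofReal (‖layerVec a h δ k ij.1 ij.2‖⁻¹ ^ 6)
      = ∑' ij : ℤ × ℤ, ∫⁻ t in Ioi (0 : ℝ),
          ENNReal.ofReal (1 / 2 * t ^ 2 * Real.exp (-t * ‖layerVec a h δ k ij.1 ij.2‖ ^ 2)) :=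
        tsum_congr fun ij => (lintegral_half_sq_mul_exp_neg_mul_sq (hpos ij)).symm
    _ = ∫⁻ t in Ioi (0 : ℝ), ∑' ij : ℤ × ℤ,
          ENNReal.ofReal (1 / 2 * t ^ 2 * Real.exp (-t * ‖layerVec a h δ k ij.1 ij.2‖ ^ 2)) :=
        (lintegral_tsum hmeas).symm
    _ = ∫⁻ t in Ioi (0 : ℝ), ∑' ij : ℤ × ℤ,
          ENNReal.ofReal (1 / 2 * t ^ 2 * Real.exp (-t * ((k : ℝ) * h) ^ 2)) *
            ENNReal.ofReal (Real.exp (-t * ‖layerVec a h δ 0 ij.1 ij.2‖ ^ 2)) := by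
        refine lintegral_congr fun t => tsum_congr fun ij => ?_
        rw [← ENNReal.ofReal_mul (by positivity)]
        congr 1
        rw [norm_layerVec_sq_eq, show -t * (‖layerVec a h δ 0 ij.1 ij.2‖ ^ 2 + ((k : ℝ) * h) ^ 2) =
          -t * ((k : ℝ) * h) ^ 2 + -t * ‖layerVec a h δ 0 ij.1 ij.2‖ ^ 2 by ring, Real.exp_add]
        ring
    _ = _ := lintegral_congr fun t => ENNReal.tsum_mul_left

/-- **Banaszczyk's inequality in `ℝ≥0∞`**: the planar Gaussian sum seen from a hole is at most that
seen from a lattice point, `Σ e^{-t‖i u + j v + w‖²} ≤ Σ e^{-t‖i u + j v‖²}` (`t > 0`). [folklore] -/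
theorem tsum_ofReal_gauss_layerVec_one_le (ha : a ≠ 0) {t : ℝ} (ht : 0 < t) (h' : ℝ) :
    ∑' ij : ℤ × ℤ, ENNReal.ofReal (Real.exp (-t * ‖layerVec a h' 1 0 ij.1 ij.2‖ ^ 2)) ≤
      ∑' ij : ℤ × ℤ, ENNReal.ofReal (Real.exp (-t * ‖layerVec a h' 0 0 ij.1 ij.2‖ ^ 2)) := by
  rw [← ENNReal.ofReal_tsum_of_nonneg (fun _ => (Real.exp_pos _).le) (summable_gauss_layerVec ha ht h' 1),
    ← ENNReal.ofReal_tsum_of_nonneg (fun _ => (Real.exp_pos _).le) (summable_gauss_layerVec ha ht h' 0)]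
  exact ENNReal.ofReal_le_ofReal (layerInteraction_one_zero_le ht ha h')

/-! ## The `r⁻⁶` interlayer couplings -/

/-- `r⁻⁶` layer interactions are non-negative. [folklore] -/
theorem layerInteraction_invSix_nonneg (a h : ℝ) (δ k : ℤ) :
    0 ≤ layerInteraction (fun r => r⁻¹ ^ 6) a h δ k :=
  tsum_nonneg fun _ => by positivity

/-- **Sign**: off the central layer the non-aligned `r⁻⁶` interaction is at most the aligned one,
`Φ₆(N, k) ≤ Φ₆(A, k)` (`k ≠ 0`). [folklore] -/
theorem layerInteraction_invSix_one_le_zero (ha : 0 < a) (hh : 0 < h) {k : ℤ} (hk : k ≠ 0) :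
    layerInteraction (fun r => r⁻¹ ^ 6) a h 1 k ≤ layerInteraction (fun r => r⁻¹ ^ 6) a h 0 k := by
  have key : ENNReal.ofReal (layerInteraction (fun r => r⁻¹ ^ 6) a h 1 k) ≤
      ENNReal.ofReal (layerInteraction (fun r => r⁻¹ ^ 6) a h 0 k) := by
    rw [ofReal_layerInteraction_invSix_eq_lintegral ha hh 1 hk,
      ofReal_layerInteraction_invSix_eq_lintegral ha hh 0 hk]
    refine setLIntegral_mono' measurableSet_Ioi fun t ht => ?_
    have hΘ := tsum_ofReal_gauss_layerVec_one_le ha.ne' (show 0 < t from ht) h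
    gcongr
  exact (ENNReal.ofReal_le_ofReal_iff (layerInteraction_invSix_nonneg a h 0 k)).1 key

/-- **The `r⁻⁶` couplings are non-negative**: `0 ≤ J_k = Φ₆(A, k) − Φ₆(N, k)` for `k ≥ 1`.
[folklore] -/
theorem barlowCoupling_invSix_nonneg (ha : 0 < a) (hh : 0 < h) {k : ℕ} (hk : 1 ≤ k) :
    0 ≤ barlowCoupling (fun r => r⁻¹ ^ 6) a h k := by
  unfold barlowCoupling
  have hk' : (k : ℤ) ≠ 0 := by exact_mod_cast (show k ≠ 0 by omega)
  linarith [layerInteraction_invSix_one_le_zero ha hh hk']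

/-- Measurability of the Bernstein integrands `t ↦ ½ t² e^{-t c} · Θ_δ(t)`. [folklore] -/
theorem measurable_bernsteinIntegrand (a h' c : ℝ) (δ : ℤ) :
    Measurable fun t : ℝ => ENNReal.ofReal (1 / 2 * t ^ 2 * Real.exp (-t * c)) *
      ∑' ij : ℤ × ℤ, ENNReal.ofReal (Real.exp (-t * ‖layerVec a h' δ 0 ij.1 ij.2‖ ^ 2)) := by
  fun_prop

/-- **The `r⁻⁶` couplings are non-increasing in the layer distance**: `J_{k+1} ≤ J_k` for `k ≥ 1`
(the Bernstein weights `e^{-t (k h)²}` decrease in `k`, and `Θ_N ≤ Θ_A`). [folklore] -/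
theorem barlowCoupling_invSix_succ_le (ha : 0 < a) (hh : 0 < h) {k : ℕ} (hk : 1 ≤ k) :
    barlowCoupling (fun r => r⁻¹ ^ 6) a h (k + 1) ≤ barlowCoupling (fun r => r⁻¹ ^ 6) a h k := by
  unfold barlowCoupling
  set L : ℤ → ℤ → ℝ := fun δ k => layerInteraction (fun r => r⁻¹ ^ 6) a h δ k with hL
  have hk0 : (k : ℤ) ≠ 0 := by exact_mod_cast (show k ≠ 0 by omega)
  have hk1 : ((k + 1 : ℕ) : ℤ) ≠ 0 := by exact_mod_cast (show k + 1 ≠ 0 by omega)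
  suffices H : L 0 ((k + 1 : ℕ) : ℤ) + L 1 k ≤ L 0 k + L 1 ((k + 1 : ℕ) : ℤ) by
    simp only [hL] at H
    linarith
  have hnn : ∀ δ k, 0 ≤ L δ k := fun δ k => layerInteraction_invSix_nonneg a h δ k
  -- the Bernstein weights and planar sums
  set w : ℤ → ℝ → ℝ≥0∞ := fun k t =>
    ENNReal.ofReal (1 / 2 * t ^ 2 * Real.exp (-t * ((k : ℝ) * h) ^ 2)) with hw
  set Θ : ℤ → ℝ → ℝ≥0∞ := fun δ t =>
    ∑' ij : ℤ × ℤ, ENNReal.ofReal (Real.exp (-t * ‖layerVec a h δ 0 ij.1 ij.2‖ ^ 2)) with hΘ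
  have hrep : ∀ δ (k : ℤ), k ≠ 0 → ENNReal.ofReal (L δ k) = ∫⁻ t in Ioi (0 : ℝ), w k t * Θ δ t :=
    fun δ k hk => ofReal_layerInteraction_invSix_eq_lintegral ha hh δ hk
  have hmeas : ∀ δ (k : ℤ), Measurable fun t => w k t * Θ δ t := fun δ k =>
    measurable_bernsteinIntegrand a h (((k : ℝ) * h) ^ 2) δ
  have key : ENNReal.ofReal (L 0 ((k + 1 : ℕ) : ℤ) + L 1 k) ≤
      ENNReal.ofReal (L 0 k + L 1 ((k + 1 : ℕ) : ℤ)) := by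
    rw [ENNReal.ofReal_add (hnn _ _) (hnn _ _), ENNReal.ofReal_add (hnn _ _) (hnn _ _),
      hrep 0 _ hk1, hrep 1 _ hk0, hrep 0 _ hk0, hrep 1 _ hk1,
      ← lintegral_add_left (hmeas 0 _), ← lintegral_add_left (hmeas 0 _)]
    refine setLIntegral_mono' measurableSet_Ioi fun t ht => ?_
    have ht' : 0 < t := ht
    -- `w (k+1) t ≤ w k t` and `Θ 1 t ≤ Θ 0 t`
    have hBA : w ((k + 1 : ℕ) : ℤ) t ≤ w k t := by
      simp only [hw]
      refine ENNReal.ofReal_le_ofReal (mul_le_mul_of_nonneg_left (Real.exp_le_exp.2 ?_)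
        (by positivity))
      have hkk : ((k : ℤ) : ℝ) * h ≤ (((k + 1 : ℕ) : ℤ) : ℝ) * h := by
        push_cast
        nlinarith
      have h0 : 0 ≤ ((k : ℤ) : ℝ) * h := by push_cast; positivity
      nlinarith [mul_self_le_mul_self h0 hkk]
    have hΘ10 : Θ 1 t ≤ Θ 0 t := tsum_ofReal_gauss_layerVec_one_le ha.ne' ht' h
    calc w ((k + 1 : ℕ) : ℤ) t * Θ 0 t + w k t * Θ 1 t
        = w ((k + 1 : ℕ) : ℤ) t * Θ 0 t +
            (w ((k + 1 : ℕ) : ℤ) t + (w k t - w ((k + 1 : ℕ) : ℤ) t)) * Θ 1 t := by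
          rw [add_tsub_cancel_of_le hBA]
      _ = w ((k + 1 : ℕ) : ℤ) t * Θ 0 t + w ((k + 1 : ℕ) : ℤ) t * Θ 1 t +
            (w k t - w ((k + 1 : ℕ) : ℤ) t) * Θ 1 t := by ring
      _ ≤ w ((k + 1 : ℕ) : ℤ) t * Θ 0 t + w ((k + 1 : ℕ) : ℤ) t * Θ 1 t +
            (w k t - w ((k + 1 : ℕ) : ℤ) t) * Θ 0 t := by gcongr
      _ = (w ((k + 1 : ℕ) : ℤ) t + (w k t - w ((k + 1 : ℕ) : ℤ) t)) * Θ 0 t +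
            w ((k + 1 : ℕ) : ℤ) t * Θ 1 t := by ring
      _ = w k t * Θ 0 t + w ((k + 1 : ℕ) : ℤ) t * Θ 1 t := by rw [add_tsub_cancel_of_le hBA]
  have hsum : 0 ≤ L 0 k + L 1 ((k + 1 : ℕ) : ℤ) := add_nonneg (hnn _ _) (hnn _ _)
  exact (ENNReal.ofReal_le_ofReal_iff hsum).1 key

/-! ## The domination -/

/-- **`r⁻⁶` site energies of Barlow stackings are maximal for hcp** (any spacings `a, h > 0`):
for every Hägg word `s` and layer `m`,
`barlowSiteEnergy (r ↦ r⁻⁶) a h s m ≤ barlowSiteEnergy (r ↦ r⁻⁶) a h alternatingHagg 0` —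
hcp maximises the van der Waals (London `r⁻⁶`) attraction among all close-packed stackings,
sitewise. [folklore] -/
theorem barlowSiteEnergy_invSix_le_alternating (ha : 0 < a) (hh : 0 < h) {s : ℤ → ℤ}
    (hs : IsHaggSeq s) (m : ℤ) :
    barlowSiteEnergy (fun r => r⁻¹ ^ 6) a h s m ≤
      barlowSiteEnergy (fun r => r⁻¹ ^ 6) a h alternatingHagg 0 := by
  have hA := summable_layerInteraction_invSix ha hh 0
  have hN := summable_layerInteraction_invSix ha hh 1
  rw [barlowSiteEnergy_eq _ a h hs hA hN m, barlowSiteEnergy_eq _ a h isHaggSeq_alternating hA hN 0]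
  set J : ℕ → ℝ := barlowCoupling (fun r => r⁻¹ ^ 6) a h with hJdef
  -- the couplings, frozen below range `2` (the ranges `0, 1` never enter the local energies)
  set J' : ℕ → ℝ := fun k => if k < 2 then J 2 else J k with hJ'def
  have hJ : Summable J := hA.sub hN
  have hJ'2 : ∀ k, 2 ≤ k → J' k = J k := fun k hk => by
    simp only [hJ'def]
    rw [if_neg (not_lt.2 hk)]
  have hJ'0 : ∀ k, 0 ≤ J' k := fun k => by
    by_cases hk : k < 2
    · simp only [hJ'def]
      rw [if_pos hk]
      exact barlowCoupling_invSix_nonneg ha hh (by norm_num)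
    · simp only [hJ'def]
      rw [if_neg hk]
      exact barlowCoupling_invSix_nonneg ha hh (by omega)
  have hmono : ∀ k, J' (k + 1) ≤ J' k := fun k => by
    rcases Nat.lt_or_ge k 1 with hk | hk
    · have hk0 : k = 0 := by omega
      subst hk0
      simp [hJ'def]
    · rcases Nat.lt_or_ge k 2 with hk2 | hk2
      · have hk1 : k = 1 := by omega
        subst hk1
        simp [hJ'def]
      · rw [hJ'2 k hk2, hJ'2 (k + 1) (by omega)]
        exact barlowCoupling_invSix_succ_le ha hh (by omega)
  have hJ' : Summable J' := by
    have h2 : Summable fun k => J (k + 2) := (summable_nat_add_iff 2).2 hJ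
    have h2' : Summable fun k => J' (k + 2) := h2.congr fun k => (hJ'2 (k + 2) (by omega)).symm
    exact (summable_nat_add_iff 2).1 h2'
  have swap : ∀ (P : ℕ → Prop) [DecidablePred P],
      ∑' k : ℕ, (if 2 ≤ k ∧ P k then J k else 0) = ∑' k : ℕ, (if 2 ≤ k ∧ P k then J' k else 0) := by
    intro P _
    refine tsum_congr fun k => ?_
    by_cases hk : 2 ≤ k ∧ P k
    · rw [if_pos hk, if_pos hk, hJ'2 k hk.1]
    · rw [if_neg hk, if_neg hk]
  have h1 : haggLocalEnergy J s m ≤ haggLocalEnergy J alternatingHagg 0 := by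
    rw [haggLocalEnergy_alternating, haggLocalEnergy, swap, swap]
    exact tsum_ite_le_tsum_ite_even (fun k _ hk => not_haggAligned_succ hs m k hk) hJ'0 hmono hJ'
  have h2 : haggBackwardLocalEnergy J s m ≤ haggBackwardLocalEnergy J alternatingHagg 0 := by
    rw [BarlowTheta.haggBackwardLocalEnergy_alternating, haggBackwardLocalEnergy, swap, swap]
    exact tsum_ite_le_tsum_ite_even (fun k _ hk => not_haggAligned_sub_succ hs m k hk) hJ'0 hmono hJ'
  linarith

end Summit.AtomisticToContinuum.Crystallization.Theorems
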